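import Summits.QuantumFields.YangMills.Theorems.F4SubCurvatureDoorShortRootRigidityTrigonalDefs
import Summits.QuantumFields.YangMills.Theorems.F4SubCurvatureDoorShortRootRigidityTrigonalReflection
import Summits.QuantumFields.YangMills.Theorems.F4SubCurvatureDoorShortRootRigidityTrigonalFinish
import Summits.QuantumFields.YangMills.Theorems.F4SubCurvatureDoorShortRootRigiditySectoralHarmonic
import Summits.QuantumFields.YangMills.Theorems.F4SubCurvatureDoorShortRootRigiditySchwarzReflection
import Summits.QuantumFields.YangMills.Theorems.F4SubCurvatureDoorShortRootRigidityTrigonalProjUniqueness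
import Summits.QuantumFields.YangMills.Theorems.F4SubCurvatureDoorShortRootRigidityTrigonalInjectivityCore
import Literature.Algebra.Polynomial.LaplacianOrthogonalInvariance
import Mathlib
import HarnessLib

/-!
# Trigonal injectivity — stubs L2 `stub_sectoralSpan`, L3 `stub_EsectValues` and the target `TrigonalInjectivityQ s` BY NAME

Sub-skeleton `Summits/QuantumFields/YangMills/Cruxes/ShortRootRigidity/Lines/trigonal_injectivity.lean` (planner ym-idea-3 g21,
b8c4174ce46e) of stub `:146 stub_oddModeRigidity` (crux ⟨stmt-QuantumFields-23035⟩ `ShortRootRigidity`); paper proof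
`Cruxes/ShortRootRigidity/TrigonalInjectivity.md` §1, §1-bis.  Over the SHARED vocabulary of
`Theorems/F4SubCurvatureDoorShortRootRigidityTrigonalDefs.lean` (frs-p2 g16; character-identical restatement of the sub-skeleton's
defs, the Props `ReflectionIdentity`/`SectoralSpan`/`EsectValues`/`Finish` of L1–L4 and the proved composition `trigonalInjectivityQ_of`;
L1 ✓`…TrigonalReflection`, L4 ✓`…TrigonalFinish` by frs-p2 g16) this file proves

* `Esect_eq_sect` — the registered rational sectoral polynomial `E_s = Σ_k (−1)^k C(6s,2k) α^{6s−2k}(β²)^k` IS the sectoral harmonic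
  `sect s = Re(A + ζB)^{6s}` of `Theorems/…SectoralHarmonic.lean` (`α + iβ = A + ζB` on the nose), hence harmonic with known values;
* `stub_EsectValues` (L3) BY NAME + SIGNATURE: `E_s(2,1,−3) = E_s(−2,3,−1) = A_s`, `E_s(0,−1,1) = 1`;
* `stub_sectoralSpan` (L2) BY NAME + SIGNATURE: `Y∘proj = a·E_s` — by the uniqueness lemma `bind₁_proj_eq_zero`
  (`Theorems/…TrigonalProjUniqueness.lean`: odd AND even under the reflection in `x₀−2x₁+x₂=0`) applied to `Y − Y(1,0,−1)·E_s`;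
* `sectoralSpan_holds : SectoralSpan s`, `esectValues_holds : EsectValues s` (the composition's hypotheses h2, h3);
* `trigonalInjectivityQ_holds : 1 ≤ s → TrigonalInjectivityQ s` — THE TARGET of the sub-skeleton for every `s ≥ 1`, TWICE: by the
  owner's composition `trigonalInjectivityQ_of` (L1 ✓frs-p2, L2 ✓here, L3 ✓here, L4 ✓frs-p2), and (`…_via_trace`) from L2 and the
  trace-form theorem `eq_zero_of_trace` (`Theorems/…TrigonalInjectivityCore.lean`).

HONEST LABEL: this is the Lean half of §1 only; `TorusReduction` (§2) and `AnalyticHalf` (R-O1) of `:146` are OPEN, so `:146`,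
⟨23035⟩, ⟨23125⟩ remain OPEN; the Yang–Mills mass gap is NOT proved; no summit is proved by a line.
-/

noncomputable section

open MvPolynomial
open scoped BigOperators
open Literature.Algebra.Polynomial
open Summit.QuantumFields.YangMills.Theorems.F4SubCurvatureDoorTrigonalLine (P3 lap J3 Pm Rf flipMat OhInvariant TrigonalInjectivityQ
  alpha betaSq Esect ab Aval eval_plane_of_span ReflectionIdentity SectoralSpan EsectValues Finish trigonalInjectivityQ_of
  reflectionIdentity_holds finish_holds)
open Summit.QuantumFields.YangMills.Theorems.F4SubCurvatureDoorSchwarzReflection (laplacian3)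
open Summit.QuantumFields.YangMills.Theorems.F4SubCurvatureDoorSectoralHarmonic (zmul zpow zpow_succ sect eval_sect
  eval_sect_P' eval_sect_Q'' piPow zpow_zeta_six_mul laplacian3_sect)
open Summit.QuantumFields.YangMills.Theorems.F4SubCurvatureDoorTrigonalProjUniqueness (bind₁_proj_eq_zero)
open Summit.QuantumFields.YangMills.Theorems.F4SubCurvatureDoorTrigonalInjectivityCore (flip1 flip2 eq_zero_of_trace)

namespace Summit.QuantumFields.YangMills.Theorems.F4SubCurvatureDoorTrigonalSectoralSpan

/-! ## `Re (a + bi)^{2n}` as a binomial sum -/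

/-- A sum over `range (2n+1)` of a sequence vanishing at odd indices is the sum over the even indices. -/
theorem sum_range_even (f : ℕ → ℝ) (hf : ∀ j, f (2 * j + 1) = 0) (n : ℕ) :
    ∑ j ∈ Finset.range (2 * n + 1), f j = ∑ k ∈ Finset.range (n + 1), f (2 * k) := by
  induction n with
  | zero => simp
  | succ n ih =>
    have h2 : 2 * (n + 1) + 1 = 2 * n + 1 + 1 + 1 := by ring
    rw [h2, Finset.sum_range_succ, Finset.sum_range_succ, ih, Finset.sum_range_succ (fun k => f (2 * k)) (n + 1), hf n,
      show 2 * n + 1 + 1 = 2 * (n + 1) by ring]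
    ring

/-- `Re i^{2j+1} = 0`. -/
theorem I_pow_odd_re (j : ℕ) : ((Complex.I : ℂ) ^ (2 * j + 1)).re = 0 := by
  rw [pow_succ, pow_mul, Complex.I_sq]
  rcases neg_one_pow_eq_or ℂ j with h | h <;> simp [h]

/-- `Re i^{2k} = (−1)^k`. -/
theorem I_pow_even_re (k : ℕ) : ((Complex.I : ℂ) ^ (2 * k)).re = (-1 : ℝ) ^ k := by
  rw [pow_mul, Complex.I_sq]
  have h : ((-1 : ℂ)) ^ k = (((-1 : ℝ) ^ k : ℝ) : ℂ) := by push_cast; ring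
  rw [h, Complex.ofReal_re]

/-- `Re (a + bi)^{2n} = Σ_{k ≤ n} (−1)^k C(2n,2k) a^{2n−2k} (b²)^k` for real `a, b`. [folklore] -/
theorem re_pow_even (a b : ℝ) (n : ℕ) :
    (((a : ℂ) + (b : ℂ) * Complex.I) ^ (2 * n)).re =
      ∑ k ∈ Finset.range (n + 1), (-1 : ℝ) ^ k * ((2 * n).choose (2 * k) : ℝ) * a ^ (2 * n - 2 * k) * (b ^ 2) ^ k := by
  have hexp : ((a : ℂ) + (b : ℂ) * Complex.I) ^ (2 * n) =
      ∑ j ∈ Finset.range (2 * n + 1), ((b ^ j * a ^ (2 * n - j) * ((2 * n).choose j : ℝ) : ℝ) : ℂ) * Complex.I ^ j := by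
    rw [add_comm, add_pow]
    refine Finset.sum_congr rfl fun j _ => ?_
    push_cast
    ring
  rw [hexp, Complex.re_sum]
  simp_rw [Complex.re_ofReal_mul]
  have hf : ∀ j, (fun j => b ^ j * a ^ (2 * n - j) * ((2 * n).choose j : ℝ) * (Complex.I ^ j).re) (2 * j + 1) = 0 := by
    intro j
    simp only [I_pow_odd_re, mul_zero]
  rw [sum_range_even _ hf n]
  refine Finset.sum_congr rfl fun k _ => ?_
  simp only [I_pow_even_re]
  rw [pow_mul]
  ring

/-! ## The pair arithmetic of `…SectoralHarmonic` is multiplication in `ℝ[ζ]`, `ζ² = −1 − ζ` -/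

/-- `(zpow p n).1 + (zpow p n).2·ζ = (p.1 + p.2 ζ)^n` for any `ζ` with `ζ² = −1 − ζ`. -/
theorem zpow_complex (ζ : ℂ) (hζ : ζ * ζ = -1 - ζ) (p : ℝ × ℝ) (n : ℕ) :
    ((zpow p n).1 : ℂ) + ((zpow p n).2 : ℂ) * ζ = ((p.1 : ℂ) + (p.2 : ℂ) * ζ) ^ n := by
  induction n with
  | zero => simp [F4SubCurvatureDoorSectoralHarmonic.zpow_zero]
  | succ n ih =>
    rw [zpow_succ, pow_succ, ← ih]
    simp only [zmul]
    push_cast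
    linear_combination (-(((zpow p n).2 : ℂ) * (p.2 : ℂ))) * hζ

/-! ## `E_s = sect s` -/

/-- Evaluation of `E_s` (closed form of the defining sum). -/
theorem eval_Esect (s : ℕ) (x : Fin 3 → ℝ) : eval x (Esect s) =
    ∑ k ∈ Finset.range (3 * s + 1), (-1 : ℝ) ^ k * ((6 * s).choose (2 * k) : ℝ) *
      ((x 0 - x 2) / 2) ^ (6 * s - 2 * k) * ((x 0 - 2 * x 1 + x 2) ^ 2 / 12) ^ k := by
  simp only [Esect, alpha, betaSq, map_sum, map_mul, map_pow, eval_C, eval_X, map_sub, map_add]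
  refine Finset.sum_congr rfl fun k _ => ?_
  ring

/-- **`E_s` IS the sectoral harmonic `sect s`** (`λ = α + iβ = A + ζB` with `A = (2x₀−x₁−x₂)/3`, `B = (x₀−2x₁+x₂)/3`,
`ζ = −1/2 + (√3/2)i`). -/
theorem Esect_eq_sect (s : ℕ) : Esect s = sect s := by
  refine MvPolynomial.funext fun x => ?_
  rw [eval_Esect, eval_sect]
  set A := F4SubCurvatureDoorSectoralHarmonic.Aval x with hA
  set B := F4SubCurvatureDoorSectoralHarmonic.Bval x with hB
  set ζ : ℂ := -1 / 2 + ((Real.sqrt 3 / 2 : ℝ) : ℂ) * Complex.I with hζdef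
  have h3 : Real.sqrt 3 ^ 2 = 3 := Real.sq_sqrt (by norm_num)
  have hζ : ζ * ζ = -1 - ζ := by
    apply Complex.ext
    · simp [hζdef, Complex.mul_re]
      nlinarith [h3]
    · simp [hζdef, Complex.mul_im]
      ring
  have ha : (x 0 - x 2) / 2 = A - B / 2 := by
    simp only [hA, hB, F4SubCurvatureDoorSectoralHarmonic.Aval, F4SubCurvatureDoorSectoralHarmonic.Bval]; ring
  have hb : (x 0 - 2 * x 1 + x 2) ^ 2 / 12 = (Real.sqrt 3 / 2 * B) ^ 2 := by
    rw [mul_pow, div_pow, h3]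
    simp only [hB, F4SubCurvatureDoorSectoralHarmonic.Bval]; ring
  rw [ha, hb, show 6 * s = 2 * (3 * s) by ring, ← re_pow_even]
  have hlin : ((A - B / 2 : ℝ) : ℂ) + ((Real.sqrt 3 / 2 * B : ℝ) : ℂ) * Complex.I = (A : ℂ) + (B : ℂ) * ζ := by
    rw [hζdef]; push_cast; ring
  have hz := zpow_complex ζ hζ (A, B) (2 * (3 * s))
  simp only at hz
  rw [hlin, ← hz]
  simp [hζdef]
  ring

/-- `E_s` is harmonic. -/
theorem laplacian3_Esect (s : ℕ) : laplacian3 (Esect s) = 0 := by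
  rw [Esect_eq_sect]; exact laplacian3_sect s

/-! ## STUB L3 — the three integer values -/

/-- The recurrence `piPow` of `…SectoralHarmonic` is the registered `ab`. -/
theorem piPow_eq_ab (n : ℕ) : piPow n = ab n := by
  induction n with
  | zero => rfl
  | succ n ih =>
    show ((2 * (piPow n).1 - 3 * (piPow n).2, (piPow n).1 + 2 * (piPow n).2) : ℤ × ℤ)
        = (2 * (ab n).1 - 3 * (ab n).2, (ab n).1 + 2 * (ab n).2)
    rw [ih]

/-- STUB L3 (S…M−) — THE THREE INTEGER VALUES, BY NAME + SIGNATURE.  `E_s(2,1,−3) = E_s(−2,3,−1) = A_s` and `E_s(0,−1,1) = 1`.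
[TrigonalInjectivity.md §1-bis (4′)] -/
theorem stub_EsectValues (s : ℕ) (hs : 1 ≤ s) :
    eval ![2, 1, -3] (Esect s) = Aval s ∧ eval ![-2, 3, -1] (Esect s) = Aval s ∧ eval ![0, -1, 1] (Esect s) = 1 := by
  have _h : 1 ≤ s := hs
  rw [Esect_eq_sect]
  refine ⟨?_, ?_, ?_⟩
  · rw [eval_sect_P', piPow_eq_ab]; rfl
  · rw [eval_sect_Q'', piPow_eq_ab]; rfl
  · rw [eval_sect]
    have hA : F4SubCurvatureDoorSectoralHarmonic.Aval ![0, -1, 1] = 0 := by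
      simp [F4SubCurvatureDoorSectoralHarmonic.Aval]
    have hB : F4SubCurvatureDoorSectoralHarmonic.Bval ![0, -1, 1] = 1 := by
      simp [F4SubCurvatureDoorSectoralHarmonic.Bval]; norm_num
    rw [hA, hB, zpow_zeta_six_mul]
    norm_num

/-! ## STUB L2 — sectoral span -/

/-- scaling of the values of a form [folklore; proof as in `Literature/Algebra/Polynomial/NonnegativeFormsSymmetries.lean`] -/
theorem eval_smul_of_isHomogeneous (f : MvPolynomial (Fin 3) ℝ) {m : ℕ} (hf : f.IsHomogeneous m) (c : ℝ) (x : Fin 3 → ℝ) :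
    eval (c • x) f = c ^ m * eval x f := by
  rw [eval_eq', eval_eq', Finset.mul_sum]
  refine Finset.sum_congr rfl fun α hα => ?_
  have hdeg : ∑ i, α i = m := by
    have h := hf (mem_support_iff.1 hα)
    rw [Finsupp.weight_apply, Finsupp.sum_fintype _ _ (by simp)] at h
    simpa using h
  simp_rw [Pi.smul_apply, smul_eq_mul, mul_pow, Finset.prod_mul_distrib, Finset.prod_pow_eq_pow_sum, hdeg]
  ring

/-- the action of the registered projection `proj = 1 − J/3` -/
theorem proj_mulVec (q : Fin 3 → ℝ) : Pm.mulVec q = fun i => q i - (q 0 + q 1 + q 2) / 3 := by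
  funext i
  fin_cases i <;> simp [Pm, J3, Matrix.mulVec, dotProduct, Fin.sum_univ_three, Matrix.one_apply] <;> ring

/-- `E_s(−p₂,−p₁,−p₀) = E_s(p)`. -/
theorem eval_Esect_negswap (s : ℕ) (p : Fin 3 → ℝ) : eval ![-p 2, -p 1, -p 0] (Esect s) = eval p (Esect s) := by
  rw [eval_Esect, eval_Esect]
  refine Finset.sum_congr rfl fun k _ => ?_
  simp only [Matrix.cons_val_zero, Matrix.cons_val_one, Matrix.head_cons, Matrix.cons_val_two, Matrix.tail_cons]
  ring

/-- `E_s(t,0,−t) = t^{6s}`. -/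
theorem eval_Esect_line (s : ℕ) (t : ℝ) : eval ![t, 0, -t] (Esect s) = t ^ (6 * s) := by
  rw [eval_Esect, Finset.sum_eq_single 0]
  · simp
  · intro k _ hk
    simp [hk]
  · intro h; simp at h

/-- `E_s ∘ proj = E_s`. -/
theorem Esect_proj (s : ℕ) : bind₁ (linSubst Pm) (Esect s) = Esect s := by
  refine MvPolynomial.funext fun x => ?_
  rw [eval_bind₁_linSubst, proj_mulVec, eval_Esect, eval_Esect]
  refine Finset.sum_congr rfl fun k _ => ?_
  ring

/-- sign flips from `O_h`-invariance, pointwise -/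
theorem eval_flip_of_OhInvariant {Y : P3} (hO : OhInvariant Y) (i : Fin 3) (x : Fin 3 → ℝ) :
    eval (fun j => if j = i then -x j else x j) Y = eval x Y := by
  have h := congrArg (eval x) (hO.2 i)
  rw [eval_bind₁_linSubst] at h
  have hv : (flipMat i).mulVec x = fun j => if j = i then -x j else x j := by
    funext j
    simp only [flipMat, Matrix.mulVec_diagonal]
    split_ifs <;> simp
  rw [hv] at h
  exact h

/-- `Y(−p₂,−p₁,−p₀) = Y(p)` from `O_h`-invariance (transposition `x₀ ↔ x₂` and the three sign flips) -/
theorem eval_negswap_of_OhInvariant {Y : P3} (hO : OhInvariant Y) (p : Fin 3 → ℝ) :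
    eval ![-p 2, -p 1, -p 0] Y = eval p Y := by
  have hswap : eval ![p 2, p 1, p 0] Y = eval p Y := by
    have h := congrArg (eval p) (hO.1 (Equiv.swap 0 2))
    rw [eval_rename] at h
    have hv : p ∘ (Equiv.swap (0 : Fin 3) 2) = ![p 2, p 1, p 0] := by
      funext j
      fin_cases j
      · simp
      · simp [Equiv.swap_apply_of_ne_of_ne]
      · simp
    rw [hv] at h
    exact h
  have h0 := eval_flip_of_OhInvariant hO 0 ![p 2, p 1, p 0]
  have h1 := eval_flip_of_OhInvariant hO 1 (fun j => if j = (0 : Fin 3) then -(![p 2, p 1, p 0] : Fin 3 → ℝ) j else ![p 2, p 1, p 0] j)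
  have h2 := eval_flip_of_OhInvariant hO 2
    (fun j => if j = (1 : Fin 3) then -(fun j => if j = (0 : Fin 3) then -(![p 2, p 1, p 0] : Fin 3 → ℝ) j else ![p 2, p 1, p 0] j) j
      else (fun j => if j = (0 : Fin 3) then -(![p 2, p 1, p 0] : Fin 3 → ℝ) j else ![p 2, p 1, p 0] j) j)
  have hv : (![-p 2, -p 1, -p 0] : Fin 3 → ℝ) = fun j => if j = (2 : Fin 3) then
      -(fun j => if j = (1 : Fin 3) then -(fun j => if j = (0 : Fin 3) then -(![p 2, p 1, p 0] : Fin 3 → ℝ) j else ![p 2, p 1, p 0] j) j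
        else (fun j => if j = (0 : Fin 3) then -(![p 2, p 1, p 0] : Fin 3 → ℝ) j else ![p 2, p 1, p 0] j) j) j
      else (fun j => if j = (1 : Fin 3) then -(fun j => if j = (0 : Fin 3) then -(![p 2, p 1, p 0] : Fin 3 → ℝ) j else ![p 2, p 1, p 0] j) j
        else (fun j => if j = (0 : Fin 3) then -(![p 2, p 1, p 0] : Fin 3 → ℝ) j else ![p 2, p 1, p 0] j) j) j := by
    funext j
    fin_cases j <;> simp
  rw [hv, h2, h1, h0, hswap]

/-- STUB L2 (M−) — SECTORAL SPAN, BY NAME + SIGNATURE.  `Y∘proj = a·E_s` with `a = Y(1,0,−1)`: the difference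
`(Y − a·E_s)∘proj` is planar-harmonic, takes equal values at `p` and `(−p₂,−p₁,−p₀)`, and vanishes on the line `ℝ(1,0,−1)`
(homogeneity of degree `6s` and `E_s(t,0,−t) = t^{6s}`), so it vanishes by `bind₁_proj_eq_zero`.  [§1 (1), §1-bis] -/
theorem stub_sectoralSpan (s : ℕ) (hs : 1 ≤ s) (Y : P3) (hY : Y.IsHomogeneous (6 * s)) (hO : OhInvariant Y)
    (hp : lap (bind₁ (linSubst Pm) Y) = 0) : ∃ a : ℝ, bind₁ (linSubst Pm) Y = a • Esect s := by
  have _h : 1 ≤ s := hs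
  set a : ℝ := eval ![1, 0, -1] Y with ha
  refine ⟨a, ?_⟩
  have hsym : ∀ p : Fin 3 → ℝ, p 0 + p 1 + p 2 = 0 →
      eval ![-p 2, -p 1, -p 0] (Y - a • Esect s) = eval p (Y - a • Esect s) := by
    intro p _
    rw [map_sub, map_sub, smul_eval, smul_eval, eval_Esect_negswap, eval_negswap_of_OhInvariant hO]
  have hline : ∀ t : ℝ, eval ![t, 0, -t] (Y - a • Esect s) = 0 := by
    intro t
    rw [map_sub, smul_eval, eval_Esect_line]
    have hv : (![t, 0, -t] : Fin 3 → ℝ) = t • (![1, 0, -1] : Fin 3 → ℝ) := by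
      funext j; fin_cases j <;> simp
    rw [hv, eval_smul_of_isHomogeneous Y hY t, ← ha]
    ring
  have hlin : laplacian3 (bind₁ (linSubst Pm) Y - a • Esect s) =
      laplacian3 (bind₁ (linSubst Pm) Y) - a • laplacian3 (Esect s) := by
    simp only [laplacian3, map_sub, Derivation.map_smul, Finset.sum_sub_distrib, Finset.smul_sum]
  have hh : laplacian3 (bind₁ (linSubst Pm) (Y - a • Esect s)) = 0 := by
    rw [map_sub, map_smul, Esect_proj, hlin, laplacian3_Esect, smul_zero, sub_zero]
    exact hp
  have hzero := bind₁_proj_eq_zero Pm proj_mulVec (Y - a • Esect s) hh hsym hline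
  rw [map_sub, map_smul, Esect_proj, sub_eq_zero] at hzero
  exact hzero

/-- h2 of the composition `trigonalInjectivityQ_of`: `SectoralSpan s` holds. -/
theorem sectoralSpan_holds (s : ℕ) : SectoralSpan s :=
  fun hs Y hY hO hp => stub_sectoralSpan s hs Y hY hO hp

/-- h3 of the composition `trigonalInjectivityQ_of`: `EsectValues s` holds. -/
theorem esectValues_holds (s : ℕ) : EsectValues s :=
  fun hs => stub_EsectValues s hs

/-! ## THE TARGET of the sub-skeleton, for every `s ≥ 1` -/

/-- **TRIGONAL INJECTIVITY (E-free rational form) for all `s ≥ 1`, BY NAME**: a real harmonic polynomial, homogeneous of degree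
`6s`, `O_h`-invariant, whose composition with the projection onto `x+y+z=0` is harmonic, vanishes.  Proof: the owner's composition
`trigonalInjectivityQ_of` fed with L1 `reflectionIdentity_holds` (frs-p2 g16), L2 `sectoralSpan_holds`, L3 `esectValues_holds` (this
file) and L4 `finish_holds` (frs-p2 g16).  HONEST LABEL: Lean half of §1 of `:146` only; `TorusReduction` (§2) and `AnalyticHalf`
(R-O1) are OPEN, so `:146`, ⟨23035⟩, ⟨23125⟩ stay OPEN; YM mass gap NOT proved. -/
theorem trigonalInjectivityQ_holds (s : ℕ) (hs : 1 ≤ s) : TrigonalInjectivityQ s :=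
  trigonalInjectivityQ_of s hs reflectionIdentity_holds (sectoralSpan_holds s) (esectValues_holds s) (finish_holds s)

/-- The same target by the second route: L2 gives the sectoral trace `Y|_Π = a·E_s = a·sect s`, and `eq_zero_of_trace`
(`…TrigonalInjectivityCore`, §1-bis steps (2′)–(7′) in trace form) concludes. -/
theorem trigonalInjectivityQ_holds_via_trace (s : ℕ) (hs : 1 ≤ s) : TrigonalInjectivityQ s := by
  intro Y hY hh hO hp
  obtain ⟨a, ha⟩ := stub_sectoralSpan s hs Y hY hO hp
  refine eq_zero_of_trace s hs Y hh (fun x => eval_flip_of_OhInvariant hO 1 x) (fun x => eval_flip_of_OhInvariant hO 2 x) a ?_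
  intro x hx
  rw [eval_plane_of_span ha x hx, Esect_eq_sect]

/-- The family form: `∀ s ≥ 1, TrigonalInjectivityQ s`. -/
theorem trigonalInjectivityQ_all : ∀ s : ℕ, 1 ≤ s → TrigonalInjectivityQ s := trigonalInjectivityQ_holds

end Summit.QuantumFields.YangMills.Theorems.F4SubCurvatureDoorTrigonalSectoralSpan

end
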